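import Literature.Barriers.Schanuel.NesterenkoModularScopeAnalytic
import Mathlib.NumberTheory.ModularForms.EisensteinSeries.E2.Summable
import Mathlib.NumberTheory.ModularForms.EisensteinSeries.QExpansion
import Mathlib.NumberTheory.ModularForms.Derivative
import Mathlib.NumberTheory.ModularForms.LevelOne.DimensionFormula
import Mathlib.Analysis.Complex.LocallyUniformLimit
import HarnessLib

/-!
# Barrier (Schanuel) `NesterenkoModularScope`: `P, Q, R` are the `q`-expansions of `E₂, E₄, E₆` — `q`-series calculus on `ℍ` (proofs only)

`Literature/Barriers/Schanuel/NesterenkoModularScopeRamanujanQExp.lean` — first of two sibling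
proofs files discharging the named fact `ramanujan1916_system`
(`NesterenkoModularScopeSeries.lean`: Ramanujan's differential system
`12θP = P² − Q`, `3θQ = PQ − R`, `2θR = PR − Q²` for the formal `q`-series
`P = 1 − 24∑σ₁(n)Xⁿ`, `Q = 1 + 240∑σ₃(n)Xⁿ`, `R = 1 − 504∑σ₅(n)Xⁿ ∈ ℤ⟦X⟧`, `θ = X d/dX`), one
of the printed inputs ("property 2)") of Nesterenko's proof (LNM 1752 Ch. 3 §3) — via Mathlib's level
one modular forms: `P, Q, R` are the `q`-expansions of `E₂, E₄, E₆` (LNM 1752 Ch. 3 §1, p. 27: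
"`E₂(τ) = P(e^{2πiτ})`, `E₄(τ) = Q(e^{2πiτ})`, `E₆(τ) = R(e^{2πiτ})`"), and the system says that the
Serre derivatives `∂₄E₄, ∂₆E₆, ∂₁E₂` are `−E₆/3, −E₄²/2, −E₄/12` (sibling file
`NesterenkoModularScopeRamanujanProofs.lean`). No new definitions.

This file holds the `q`-series calculus on `ℍ` needed to identify `q`-coefficients:
* `hasSum_normalizedDeriv_qSeries` — `D(∑ cₘqᵐ) = ∑ m cₘ qᵐ` (`D = (2πi)⁻¹d/dτ`; termwise
  differentiation of a locally uniformly convergent series of holomorphic functions);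
* `hasSum_mul_qSeries` — Cauchy product of two `q`-series (coefficients of the product of the
  formal series);
* `hasSum_E₂`, `hasSum_E₄`, `hasSum_E₆`, `hasSum_E₄_sq` — `E₂, E₄, E₆, E₄²` are the sums of the
  `q`-series with the coefficients of `P, Q, R, Q²` (from Mathlib's `hasSum_qExpansion_E2`,
  `E_qExpansion_coeff`, `B₄ = −1/30`, `B₆ = 1/42`), `qExpansion_E₄_coeff`, `qExpansion_E₆_coeff`;
* `norm_coeff_P_le` & co. (polynomial coefficient bounds), `levelOne_weight_eight_rank_one`
  (`dim M₈(SL₂(ℤ)) = 1`), `mdifferentiable_D2_S` (the anomaly `2πi/z` of `E₂` is holomorphic).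

## References

* [NesterenkoPhilippon2001] Yu. V. Nesterenko, P. Philippon (eds.), LNM 1752 (2001), Ch. 3 §1
  (p. 27: `P, Q, R`, their relation to `E₂, E₄, E₆`, Ramanujan's system (2)); Ch. 1 §1 (D. Bertrand:
  the differential ring of modular forms, (1)).
* S. Ramanujan, *On certain arithmetical functions*, Trans. Cambridge Phil. Soc. 22 (1916) 159–184.
-/

noncomputable section

open UpperHalfPlane hiding I
open Complex Filter Topology ModularForm EisensteinSeries Derivative
open scoped Real MatrixGroups CongruenceSubgroup ArithmeticFunction.sigma Manifold

namespace Literature.Barriers.Schanuel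

/-! ### `q`-series on `ℍ`: termwise derivative and Cauchy product -/

/-- **Termwise normalized derivative of a `q`-series on `ℍ`.** If `f(τ) = ∑ₘ cₘ qᵐ` (`q = e^{2πiτ}`)
for all `τ ∈ ℍ`, with polynomially bounded coefficients `|cₘ| ≤ C (m+1)^k`, then
`D f(τ) = ∑ₘ m cₘ qᵐ`, `D = (2πi)⁻¹ d/dτ` (`Derivative.normalizedDerivOfComplex`): locally uniform
convergence on `{Im w > Im τ / 2}` and `Complex.hasSum_deriv_of_summable_norm`. [folklore] -/
theorem hasSum_normalizedDeriv_qSeries {f : ℍ → ℂ} {c : ℕ → ℂ} {C : ℝ} {k : ℕ}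
    (hc : ∀ n, ‖c n‖ ≤ C * ((n : ℝ) + 1) ^ k)
    (hf : ∀ τ : ℍ, HasSum (fun m => c m * cexp (2 * π * Complex.I * τ) ^ m) (f τ)) (τ : ℍ) :
    HasSum (fun m : ℕ => ((m : ℂ) * c m) * cexp (2 * π * Complex.I * τ) ^ m)
      (normalizedDerivOfComplex f τ) := by
  set y₀ : ℝ := τ.im / 2 with hy₀def
  have hy₀ : 0 < y₀ := by have := τ.im_pos; positivity
  set U : Set ℂ := {w | y₀ < w.im} with hUdef
  have hU : IsOpen U := isOpen_lt continuous_const Complex.continuous_im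
  have hτU : (τ : ℂ) ∈ U := by
    simp only [hUdef, Set.mem_setOf_eq, UpperHalfPlane.coe_im]
    have := τ.im_pos; linarith
  set F : ℕ → ℂ → ℂ := fun m w => c m * cexp (2 * π * Complex.I * m * w) with hFdef
  have hFdiff : ∀ m, Differentiable ℂ (F m) := fun m => by
    simp only [hFdef]; fun_prop
  have hF : ∀ m, DifferentiableOn ℂ (F m) U := fun m => (hFdiff m).differentiableOn
  set r : ℝ := Real.exp (-(2 * π * y₀)) with hrdef
  have hr0 : 0 ≤ r := (Real.exp_pos _).le
  have hr1 : r < 1 := by rw [hrdef, Real.exp_lt_one_iff]; have := Real.pi_pos; nlinarith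
  have hexp : ∀ (m : ℕ) (w : ℂ), ‖cexp (2 * π * Complex.I * m * w)‖ =
      Real.exp (-(2 * π * w.im)) ^ m := by
    intro m w
    rw [Complex.norm_exp, ← Real.exp_nat_mul]
    congr 1
    simp only [Complex.mul_re, Complex.mul_im, Complex.re_ofNat, Complex.im_ofNat,
      Complex.ofReal_re, Complex.ofReal_im, Complex.I_re, Complex.I_im, Complex.natCast_re,
      Complex.natCast_im]
    ring
  have hbound : ∀ (m : ℕ) (w : ℂ), w ∈ U → ‖F m w‖ ≤ ‖c m‖ * r ^ m := by
    intro m w hw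
    simp only [hUdef, Set.mem_setOf_eq] at hw
    simp only [hFdef, norm_mul, hexp]
    refine mul_le_mul_of_nonneg_left (pow_le_pow_left₀ (Real.exp_pos _).le ?_ m) (norm_nonneg _)
    rw [hrdef, Real.exp_le_exp]
    have := Real.pi_pos; nlinarith
  have hsumr : Summable fun m => ‖c m‖ * r ^ m := by
    have h := summable_norm_mul_pow_of_le hc (z := (r : ℂ))
      (by rw [Complex.norm_real, Real.norm_eq_abs, abs_of_nonneg hr0]; exact hr1)
    refine h.congr fun m => ?_
    rw [norm_mul, norm_pow, Complex.norm_real, Real.norm_eq_abs, abs_of_nonneg hr0]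
  have hsum := Complex.hasSum_deriv_of_summable_norm hsumr hF hU hbound hτU
  have hderiv : ∀ m, deriv (F m) τ =
      c m * (2 * π * Complex.I * m) * cexp (2 * π * Complex.I * τ) ^ m := by
    intro m
    simp only [hFdef]
    rw [← Complex.exp_nat_mul, deriv_const_mul _ (by fun_prop)]
    have h1 : HasDerivAt (fun w : ℂ => cexp (2 * π * Complex.I * m * w))
        (cexp (2 * π * Complex.I * m * τ) * (2 * π * Complex.I * m)) τ := by
      have := ((hasDerivAt_id (τ : ℂ)).const_mul (2 * π * Complex.I * m)).cexp
      simpa using this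
    rw [h1.deriv]
    ring_nf
  have heq : (f ∘ ofComplex) =ᶠ[𝓝 (τ : ℂ)] fun w => ∑' m, F m w := by
    filter_upwards [hU.mem_nhds hτU] with w hw
    have hw0 : 0 < w.im := lt_trans hy₀ hw
    simp only [Function.comp_apply, ofComplex_apply_of_im_pos hw0, hFdef]
    have h := (hf ⟨w, hw0⟩).tsum_eq
    rw [← h]
    refine tsum_congr fun m => ?_
    rw [← Complex.exp_nat_mul]
    ring_nf
  have hD : normalizedDerivOfComplex f τ =
      (2 * π * Complex.I)⁻¹ * deriv (fun w => ∑' m, F m w) τ := by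
    rw [normalizedDerivOfComplex, heq.deriv_eq]
  rw [hD]
  have h2 := hsum.mul_left (2 * π * Complex.I)⁻¹
  have hpi : (2 * π * Complex.I : ℂ) ≠ 0 := by
    have := Real.pi_pos
    simp [Complex.ext_iff, this.ne']
  have hfun : (fun m : ℕ => ((m : ℂ) * c m) * cexp (2 * π * Complex.I * τ) ^ m) =
      fun m => (2 * π * Complex.I)⁻¹ * deriv (F m) τ := by
    funext m
    rw [hderiv]
    field_simp
  rw [hfun]
  exact h2

/-- **Cauchy product of two `q`-series on `ℍ`.** If `f(τ) = ∑ cₘ qᵐ` and `g(τ) = ∑ dₘ qᵐ` with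
polynomially bounded coefficients, then `f(τ) g(τ) = ∑ₘ (∑_{k+l=m} c_k d_l) qᵐ`, the coefficients
being those of the product of the formal series `∑ cₘ Xᵐ · ∑ dₘ Xᵐ` (absolute convergence,
`tsum_mul_tsum_eq_tsum_sum_antidiagonal_of_summable_norm`). [folklore] -/
theorem hasSum_mul_qSeries {f g : ℍ → ℂ} {c d : ℕ → ℂ} {C₁ C₂ : ℝ} {k₁ k₂ : ℕ}
    (hc : ∀ n, ‖c n‖ ≤ C₁ * ((n : ℝ) + 1) ^ k₁) (hd : ∀ n, ‖d n‖ ≤ C₂ * ((n : ℝ) + 1) ^ k₂)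
    (hf : ∀ τ : ℍ, HasSum (fun m => c m * cexp (2 * π * Complex.I * τ) ^ m) (f τ))
    (hg : ∀ τ : ℍ, HasSum (fun m => d m * cexp (2 * π * Complex.I * τ) ^ m) (g τ)) (τ : ℍ) :
    HasSum (fun m : ℕ => (PowerSeries.coeff m (PowerSeries.mk c * PowerSeries.mk d)) *
      cexp (2 * π * Complex.I * τ) ^ m) (f τ * g τ) := by
  have hq1 : ‖cexp (2 * π * Complex.I * τ)‖ < 1 := UpperHalfPlane.norm_exp_two_pi_I_lt_one τ
  have hcn : Summable fun m => ‖c m * cexp (2 * π * Complex.I * τ) ^ m‖ :=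
    summable_norm_mul_pow_of_le hc hq1
  have hdn : Summable fun m => ‖d m * cexp (2 * π * Complex.I * τ) ^ m‖ :=
    summable_norm_mul_pow_of_le hd hq1
  have hprod := tsum_mul_tsum_eq_tsum_sum_antidiagonal_of_summable_norm hcn hdn
  have hS := summable_sum_mul_antidiagonal_of_summable_norm' hcn hcn.of_norm hdn hdn.of_norm
  rw [(hf τ).tsum_eq, (hg τ).tsum_eq] at hprod
  have hfun : (fun m : ℕ => (PowerSeries.coeff m (PowerSeries.mk c * PowerSeries.mk d)) *
      cexp (2 * π * Complex.I * τ) ^ m) =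
      fun n => ∑ kl ∈ Finset.HasAntidiagonal.antidiagonal n,
        (c kl.1 * cexp (2 * π * Complex.I * τ) ^ kl.1) *
          (d kl.2 * cexp (2 * π * Complex.I * τ) ^ kl.2) := by
    funext m
    rw [PowerSeries.coeff_mul, Finset.sum_mul]
    refine Finset.sum_congr rfl fun kl hkl => ?_
    rw [Finset.HasAntidiagonal.mem_antidiagonal] at hkl
    rw [PowerSeries.coeff_mk, PowerSeries.coeff_mk, ← hkl, pow_add]
    ring
  rw [hfun, hprod]
  exact hS.hasSum

/-! ### The `q`-expansions of `E₂, E₄, E₆` are `P, Q, R` -/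

/-- **`Q` is the `q`-expansion of `E₄`**: `E₄(τ) = ∑ₘ (coeff m Q) qᵐ`, `Q = 1 + 240 ∑ σ₃(n) Xⁿ`
(Mathlib's `EisensteinSeries.E_qExpansion_coeff` with `B₄ = −1/30`).
[cite: NesterenkoPhilippon2001, Ch. 3 §1 (E₄(τ) = Q(e^{2πiτ}), p. 27)] -/
theorem hasSum_E₄ (τ : ℍ) :
    HasSum (fun m : ℕ => PowerSeries.coeff m (ramanujanQSeries.map (Int.castRingHom ℂ)) *
      cexp (2 * π * Complex.I * τ) ^ m) (E₄ τ) := by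
  have h := hasSum_qExpansion (f := (E₄ : ℍ → ℂ)) one_pos
    (SlashInvariantFormClass.periodic_comp_ofComplex E₄ one_mem_strictPeriods_SL)
    (ModularFormClass.holo E₄) (ModularFormClass.bdd_at_infty E₄) τ
  convert h using 2 with m
  rw [E_qExpansion_coeff (by norm_num) ⟨2, rfl⟩ m, PowerSeries.coeff_map, coeff_ramanujanQSeries,
    show bernoulli 4 = -1 / 30 by decide +kernel]
  simp only [Function.Periodic.qParam, ofReal_one, div_one, smul_eq_mul, map_add, map_mul,
    eq_intCast]
  split_ifs with hm
  · subst hm; simp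
  · push_cast; ring

/-- **`R` is the `q`-expansion of `E₆`**: `E₆(τ) = ∑ₘ (coeff m R) qᵐ`, `R = 1 − 504 ∑ σ₅(n) Xⁿ`
(`B₆ = 1/42`). [cite: NesterenkoPhilippon2001, Ch. 3 §1 (E₆(τ) = R(e^{2πiτ}), p. 27)] -/
theorem hasSum_E₆ (τ : ℍ) :
    HasSum (fun m : ℕ => PowerSeries.coeff m (ramanujanRSeries.map (Int.castRingHom ℂ)) *
      cexp (2 * π * Complex.I * τ) ^ m) (E₆ τ) := by
  have h := hasSum_qExpansion (f := (E₆ : ℍ → ℂ)) one_pos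
    (SlashInvariantFormClass.periodic_comp_ofComplex E₆ one_mem_strictPeriods_SL)
    (ModularFormClass.holo E₆) (ModularFormClass.bdd_at_infty E₆) τ
  convert h using 2 with m
  rw [E_qExpansion_coeff (by norm_num) ⟨3, rfl⟩ m, PowerSeries.coeff_map, coeff_ramanujanRSeries,
    show bernoulli 6 = 1 / 42 by decide +kernel]
  simp only [Function.Periodic.qParam, ofReal_one, div_one, smul_eq_mul, map_sub, map_mul,
    eq_intCast]
  split_ifs with hm
  · subst hm; simp
  · push_cast; ring

/-- **`P` is the `q`-expansion of `E₂`**: `E₂(τ) = ∑ₘ (coeff m P) qᵐ`, `P = 1 − 24 ∑ σ₁(n) Xⁿ`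
(Mathlib's `EisensteinSeries.hasSum_qExpansion_E2`).
[cite: NesterenkoPhilippon2001, Ch. 3 §1 (E₂(τ) = P(e^{2πiτ}), p. 27)] -/
theorem hasSum_E₂ (τ : ℍ) :
    HasSum (fun m : ℕ => PowerSeries.coeff m (ramanujanPSeries.map (Int.castRingHom ℂ)) *
      cexp (2 * π * Complex.I * τ) ^ m) (E2 τ) := by
  have h := hasSum_qExpansion_E2 (z := τ)
  convert h using 2 with m
  rw [PowerSeries.coeff_map, coeff_ramanujanPSeries]
  simp only [smul_eq_mul, map_sub, map_mul, eq_intCast]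
  split_ifs with hm
  · subst hm; simp
  · push_cast; ring

/-- The bundled `q`-expansion of the modular form `E₆` has the coefficients of `R`. [folklore] -/
theorem qExpansion_E₆_coeff (m : ℕ) :
    (qExpansion 1 E₆).coeff m = PowerSeries.coeff m (ramanujanRSeries.map (Int.castRingHom ℂ)) := by
  refine (ModularFormClass.qExpansion_coeff_unique one_pos one_mem_strictPeriods_SL (f := E₆)
    (c := fun m => PowerSeries.coeff m (ramanujanRSeries.map (Int.castRingHom ℂ)))
    (fun τ => ?_) m).symm
  simpa only [Function.Periodic.qParam, ofReal_one, div_one, smul_eq_mul] using hasSum_E₆ τ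

/-- The bundled `q`-expansion of the modular form `E₄` has the coefficients of `Q`. [folklore] -/
theorem qExpansion_E₄_coeff (m : ℕ) :
    (qExpansion 1 E₄).coeff m = PowerSeries.coeff m
        (PowerSeries.map (Int.castRingHom ℂ) ramanujanQSeries) := by
  refine (ModularFormClass.qExpansion_coeff_unique one_pos one_mem_strictPeriods_SL (f := E₄)
    (c := fun m => PowerSeries.coeff m
        (PowerSeries.map (Int.castRingHom ℂ) ramanujanQSeries)) (fun τ => ?_) m).symm
  simpa only [Function.Periodic.qParam, ofReal_one, div_one, smul_eq_mul] using hasSum_E₄ τ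

/-! ### Coefficient bounds, `E₄²`, `dim M₈ = 1`, the anomaly of `E₂` -/

/-- `|coeff m P| ≤ 505 (m+1)⁶`. [folklore] -/
theorem norm_coeff_P_le (n : ℕ) :
    ‖PowerSeries.coeff n (ramanujanPSeries.map (Int.castRingHom ℂ))‖ ≤ 505 * ((n : ℝ) + 1) ^ 6 :=
  norm_coeff_generator_le 1 n

/-- `|coeff m Q| ≤ 505 (m+1)⁶`. [folklore] -/
theorem norm_coeff_Q_le (n : ℕ) :
    ‖PowerSeries.coeff n (ramanujanQSeries.map (Int.castRingHom ℂ))‖ ≤ 505 * ((n : ℝ) + 1) ^ 6 :=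
  norm_coeff_generator_le 2 n

/-- `|coeff m R| ≤ 505 (m+1)⁶`. [folklore] -/
theorem norm_coeff_R_le (n : ℕ) :
    ‖PowerSeries.coeff n (ramanujanRSeries.map (Int.castRingHom ℂ))‖ ≤ 505 * ((n : ℝ) + 1) ^ 6 :=
  norm_coeff_generator_le 3 n

/-- The `q`-series of `E₄²`: coefficients of `Q²`. [folklore] -/
theorem hasSum_E₄_sq (τ : ℍ) :
    HasSum (fun m : ℕ => PowerSeries.coeff m ((PowerSeries.map (Int.castRingHom ℂ)
        ramanujanQSeries) * (PowerSeries.map (Int.castRingHom ℂ) ramanujanQSeries))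
        * cexp (2 * π * Complex.I * τ) ^ m)
      ((E₄.mul E₄) τ) := by
  have h := hasSum_mul_qSeries norm_coeff_Q_le norm_coeff_Q_le hasSum_E₄ hasSum_E₄ τ
  have hQQ : (PowerSeries.mk fun m => PowerSeries.coeff m
      (PowerSeries.map (Int.castRingHom ℂ) ramanujanQSeries)) *
      (PowerSeries.mk fun m => PowerSeries.coeff m
          (PowerSeries.map (Int.castRingHom ℂ) ramanujanQSeries)) =
          (PowerSeries.map (Int.castRingHom ℂ) ramanujanQSeries) *
          (PowerSeries.map (Int.castRingHom ℂ) ramanujanQSeries) := by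
    congr 1 <;> ext n <;> simp
  rw [hQQ] at h
  rw [ModularForm.coe_mul, Pi.mul_apply]
  exact h

/-- `dim M₈(SL₂(ℤ)) = 1` (Mathlib's `ModularForm.rank_eq_one_add_rank_cuspForm` and
`CuspForm.rank_eq_zero_of_weight_lt_twelve`). [folklore] -/
theorem levelOne_weight_eight_rank_one : Module.rank ℂ (ModularForm 𝒮ℒ 8) = 1 :=
  (ModularForm.rank_eq_one_add_rank_cuspForm (by norm_num) ⟨4, rfl⟩).trans
    ((congrArg (1 + ·) (CuspForm.rank_eq_zero_of_weight_lt_twelve (by norm_num))).trans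
      (by norm_cast))

/-- The anomaly `D₂(S)(z) = 2πi/z` of `E₂` under `S` is holomorphic on `ℍ`. [folklore] -/
theorem mdifferentiable_D2_S : MDiff (D2 ModularGroup.S) := by
  rw [UpperHalfPlane.mdifferentiable_iff]
  have h : DifferentiableOn ℂ (fun w : ℂ => 2 * π * Complex.I / w) upperHalfPlaneSet :=
    DifferentiableOn.div (differentiableOn_const _) differentiableOn_id fun w hw => by
      intro h0
      have : (0 : ℝ) < w.im := hw
      rw [h0, Complex.zero_im] at this
      exact lt_irrefl _ this
  refine h.congr fun w hw => ?_
  have hw' : 0 < w.im := hw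
  simp only [Function.comp_apply, ofComplex_apply_of_im_pos hw', D2_S]

end Literature.Barriers.Schanuel

end
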